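import Mathlib.Analysis.Calculus.BumpFunction.Convolution
import Mathlib.Analysis.Convolution
import Mathlib.Analysis.SpecialFunctions.Pow.Real
import Mathlib.Analysis.PSeries
import Literature.NumberTheory.LFunctions.WeilExplicitProofs
import Literature.NumberTheory.LFunctions.WeilMellinInversion
import Literature.NumberTheory.LFunctions.WeilArchimedeanMoments
import Literature.NumberTheory.LFunctions.ExplicitFormulaPsiOne
import Literature.Analysis.SpecialFunctions.DigammaLogBound
import Summits.RiemannHypothesis.RiemannHypothesis.Theorems.WindowTraceArch.Negative.LocalWeyl
import HarnessLib

/-!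
# The window identity for continuous band-limited tests — tools (`stub_bandlimitedTest`, Aux)

Auxiliary lemmas for the stub `stub_bandlimitedTest` of the line `defect-compactness-design`
(wave 2, structure of witnesses) for the crux `WindowTraceArch` (stmt-RiemannHypothesis-11195;
skeleton `Summit.RiemannHypothesis.RiemannHypothesis.Cruxes.WindowTraceArch.DefectCompactnessDesign`).

**What is proved here.**
* `stub_bandlimitedTest_summable`: for a witness `γ : ι → ℝ` of the crux (a real family
  reproducing the Weil functional on every Weil test supported in `[-log 2, log 2]`) the series
  `Σᵢ (1 + γᵢ²)⁻¹` converges. Input: the local Weyl law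
  `#{i : |γᵢ - T| ≤ 1} ≤ C (1 + log(1 + |T|))` (`card_near_le_log_of_windowTraceArch_witness`);
  the indices of a finset are sorted into the integer cells `⌊γᵢ⌋ = m`, each of which contributes
  `≤ 3 C (1 + log(2 + |m|)) / (1 + m²)`, a summable weight (`log u ≤ 2 √u`, `Σ |m|^{-3/2} < ∞`).
* The approximants of a continuous `g` supported in `[-A, A]`: the mollified dilates
  `h = φ̄ ⋆ g(c ·)` (`φ̄` a normalised smooth bump of radius `r`, `c ≥ 1`, `A/c + r ≤ A`) are Weil
  tests supported in `[-A, A]` with `ĥ(s) = φ̄^(s) · c⁻¹ ĝ(1/2 + (s - 1/2)/c)`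
  (`stub_bandlimitedTest_approx`; multiplicativity `weilMellin_weilConv_holds` and the change of
  variables `t ↦ t/c`), `|φ̄^(1/2 + iu)| ≤ 1`, `φ̄^(s) → 1` as `r → 0`
  (`ContDiffBump.convolution_tendsto_right_of_continuous`), and `h(0) → g(0)`.
* `stub_bandlimitedTest_arch_tendsto`: dominated convergence for the archimedean integrals
  `∫ F̂ₖ(1/2 + it) Re ψ(1/4 + it/2) dt` under a uniform bound `|F̂ₖ(1/2 + it)| ≤ M/(1 + t²)`, with the
  integrable majorant `M (|C_ψ| + 2 log(1 + |t|))/(1/4 + t²)` (`exists_norm_digamma_vertical_le`,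
  `PsiOneExplicit.integrable_left_majorant`).

**Sources.** Standard real analysis (approximate identities, dominated convergence; e.g.
E. M. Stein, R. Shakarchi, *Real Analysis* (2005), Ch. 2–3), the bound `‖ψ(a + iy)‖ ≤ C_a + log(1 + |y|)`
and cell counting. All ingredients are proved tree / Mathlib facts. [folklore]
-/

set_option linter.dupNamespace false

noncomputable section

open Complex Filter Set MeasureTheory
open scoped Real Topology BigOperators Convolution ContDiff

namespace Summit.RiemannHypothesis.RiemannHypothesis.Theorems.SpectralTraceWindowTraceArch

open Literature.NumberTheory.LFunctions
open Summit.RiemannHypothesis.RiemannHypothesis.Theorems.WindowTraceArch.Negative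

/-! ## Summability over a witness: `Σᵢ (1 + γᵢ²)⁻¹ < ∞` from the local Weyl law -/

/-- The weight series `Σ_{m ∈ ℤ} (1 + log(2 + |m|)) / (1 + m²)` converges
(`log u ≤ 2 √u`, comparison with `Σ |m|^{-3/2}`). [folklore] -/
theorem stub_bandlimitedTest_summable_weight :
    Summable fun m : ℤ => (1 + Real.log (2 + |(m : ℝ)|)) * (1 + (m : ℝ) ^ 2)⁻¹ := by
  have h1 : Summable fun m : ℤ => 5 * |(m : ℝ)| ^ (-(3 / 2 : ℝ)) :=
    (Real.summable_abs_int_rpow (by norm_num)).mul_left 5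
  refine Summable.of_norm_bounded_eventually h1 ?_
  filter_upwards [eventually_cofinite_ne 0] with m hm
  have hu : (1 : ℝ) ≤ |(m : ℝ)| := by
    have h : (1 : ℤ) ≤ |m| := Int.one_le_abs hm
    have h' : ((1 : ℤ) : ℝ) ≤ ((|m| : ℤ) : ℝ) := by exact_mod_cast h
    simpa [Int.cast_abs] using h'
  set u : ℝ := |(m : ℝ)| with hu_def
  have hu0 : 0 < u := by linarith
  have hlog0 : 0 ≤ Real.log (2 + u) := Real.log_nonneg (by linarith)
  rw [Real.norm_of_nonneg (by positivity)]
  -- `log (2 + u) ≤ log u + 2`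
  have hlog1 : Real.log (2 + u) ≤ Real.log u + 2 := by
    have h := Real.log_le_sub_one_of_pos (by positivity : (0 : ℝ) < (2 + u) / u)
    rw [Real.log_div (by positivity) hu0.ne'] at h
    have e : (2 + u) / u - 1 = 2 / u := by field_simp; ring
    have h2u : 2 / u ≤ 2 := by rw [div_le_iff₀ hu0]; nlinarith
    linarith
  -- `log u ≤ 2 u^{1/2}`
  have hlog2 : Real.log u ≤ 2 * u ^ (1 / 2 : ℝ) := by
    have h := Real.log_le_rpow_div hu0.le (by norm_num : (0 : ℝ) < 1 / 2)
    rw [le_div_iff₀ (by norm_num : (0 : ℝ) < 1 / 2)] at h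
    linarith
  have hone : 1 ≤ u ^ (1 / 2 : ℝ) := Real.one_le_rpow hu (by norm_num)
  have hnum : 1 + Real.log (2 + u) ≤ 5 * u ^ (1 / 2 : ℝ) := by linarith
  have hden : u ^ 2 ≤ 1 + (m : ℝ) ^ 2 := by rw [hu_def, sq_abs]; linarith
  have hkey : u ^ (1 / 2 : ℝ) * (u ^ 2)⁻¹ = u ^ (-(3 / 2 : ℝ)) := by
    rw [← Real.rpow_natCast u 2, ← Real.rpow_neg hu0.le, ← Real.rpow_add hu0]
    norm_num
  calc (1 + Real.log (2 + u)) * (1 + (m : ℝ) ^ 2)⁻¹ ≤ 5 * u ^ (1 / 2 : ℝ) * (u ^ 2)⁻¹ :=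
        mul_le_mul hnum (inv_anti₀ (by positivity) hden) (by positivity) (by positivity)
    _ = 5 * u ^ (-(3 / 2 : ℝ)) := by rw [mul_assoc, hkey]

/-- Uniform bound on the partial sums of `(1 + γᵢ²)⁻¹` for a family with the local count
`#{i ∈ s : |γᵢ - T| ≤ 1} ≤ C (1 + log(1 + |T|))`: sort the indices into the integer cells
`⌊γᵢ⌋ = m`; a cell holds `≤ C (1 + log(2 + |m|))` indices, each with
`(1 + γᵢ²)⁻¹ ≤ 3 (1 + m²)⁻¹`. [folklore] -/
theorem stub_bandlimitedTest_sum_le {ι : Type*} (γ : ι → ℝ) (C : ℝ)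
    (hcnt : ∀ (T : ℝ) (s : Finset ι), (∀ i ∈ s, |γ i - T| ≤ 1) →
      (s.card : ℝ) ≤ C * (1 + Real.log (1 + |T|)))
    (s : Finset ι) :
    ∑ i ∈ s, (1 + γ i ^ 2)⁻¹ ≤
      3 * C * ∑' m : ℤ, (1 + Real.log (2 + |(m : ℝ)|)) * (1 + (m : ℝ) ^ 2)⁻¹ := by
  classical
  have hC : 0 ≤ C := by simpa using hcnt 0 ∅ (by simp)
  set φ : ι → ℤ := fun i => ⌊γ i⌋ with hφ
  rw [← Finset.sum_fiberwise_of_maps_to (g := φ) (t := s.image φ)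
    (fun i hi => Finset.mem_image_of_mem φ hi)]
  have hw0 : ∀ m : ℤ, 0 ≤ (1 + Real.log (2 + |(m : ℝ)|)) * (1 + (m : ℝ) ^ 2)⁻¹ := fun m => by
    have : 0 ≤ Real.log (2 + |(m : ℝ)|) := Real.log_nonneg (by linarith [abs_nonneg (m : ℝ)])
    positivity
  -- the bound on one cell
  have hfib : ∀ m : ℤ, ∑ i ∈ s with φ i = m, (1 + γ i ^ 2)⁻¹ ≤
      3 * C * ((1 + Real.log (2 + |(m : ℝ)|)) * (1 + (m : ℝ) ^ 2)⁻¹) := by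
    intro m
    have hcell : ∀ i ∈ s.filter (fun i => φ i = m), (m : ℝ) ≤ γ i ∧ γ i < m + 1 := by
      intro i hi
      have hi' : ⌊γ i⌋ = m := (Finset.mem_filter.1 hi).2
      exact ⟨hi' ▸ Int.floor_le (γ i), hi' ▸ Int.lt_floor_add_one (γ i)⟩
    -- the count at `T = m + 1/2`
    have hcard : ((s.filter (fun i => φ i = m)).card : ℝ) ≤
        C * (1 + Real.log (2 + |(m : ℝ)|)) := by
      refine (hcnt ((m : ℝ) + 1 / 2) _ (fun i hi => ?_)).trans ?_
      · obtain ⟨h1, h2⟩ := hcell i hi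
        exact abs_le.2 ⟨by linarith, by linarith⟩
      · refine mul_le_mul_of_nonneg_left ?_ hC
        have hx : (0 : ℝ) < 1 + |(m : ℝ) + 1 / 2| := by positivity
        have hxy : 1 + |(m : ℝ) + 1 / 2| ≤ 2 + |(m : ℝ)| := by
          calc 1 + |(m : ℝ) + 1 / 2| ≤ 1 + (|(m : ℝ)| + |(1 / 2 : ℝ)|) := by
                gcongr; exact abs_add_le _ _
            _ ≤ 2 + |(m : ℝ)| := by
                rw [abs_of_pos (by norm_num : (0 : ℝ) < 1 / 2)]
                linarith
        linarith [Real.log_le_log hx hxy]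
    -- the termwise bound on the cell
    have hterm : ∀ i ∈ s.filter (fun i => φ i = m),
        (1 + γ i ^ 2)⁻¹ ≤ 3 * (1 + (m : ℝ) ^ 2)⁻¹ := by
      intro i hi
      obtain ⟨h1, h2⟩ := hcell i hi
      rw [← div_eq_mul_inv, le_div_iff₀ (by positivity), inv_mul_le_iff₀ (by positivity)]
      have hd : ((m : ℝ) - γ i) ^ 2 ≤ 1 := by nlinarith
      nlinarith [sq_nonneg (γ i - ((m : ℝ) - γ i)), hd]
    calc ∑ i ∈ s with φ i = m, (1 + γ i ^ 2)⁻¹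
        ≤ ∑ i ∈ s with φ i = m, 3 * (1 + (m : ℝ) ^ 2)⁻¹ := Finset.sum_le_sum hterm
      _ = ((s.filter (fun i => φ i = m)).card : ℝ) * (3 * (1 + (m : ℝ) ^ 2)⁻¹) := by
          rw [Finset.sum_const, nsmul_eq_mul]
      _ ≤ C * (1 + Real.log (2 + |(m : ℝ)|)) * (3 * (1 + (m : ℝ) ^ 2)⁻¹) := by
          gcongr
      _ = 3 * C * ((1 + Real.log (2 + |(m : ℝ)|)) * (1 + (m : ℝ) ^ 2)⁻¹) := by ring
  calc ∑ m ∈ s.image φ, ∑ i ∈ s with φ i = m, (1 + γ i ^ 2)⁻¹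
      ≤ ∑ m ∈ s.image φ, 3 * C * ((1 + Real.log (2 + |(m : ℝ)|)) * (1 + (m : ℝ) ^ 2)⁻¹) :=
        Finset.sum_le_sum fun m _ => hfib m
    _ = 3 * C * ∑ m ∈ s.image φ, (1 + Real.log (2 + |(m : ℝ)|)) * (1 + (m : ℝ) ^ 2)⁻¹ := by
        rw [Finset.mul_sum]
    _ ≤ 3 * C * ∑' m : ℤ, (1 + Real.log (2 + |(m : ℝ)|)) * (1 + (m : ℝ) ^ 2)⁻¹ := by
        have h3C : 0 ≤ 3 * C := by positivity
        exact mul_le_mul_of_nonneg_left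
          (stub_bandlimitedTest_summable_weight.sum_le_tsum _ (fun m _ => hw0 m)) h3C

/-- **Summability over a witness.** For a witness `γ` of the crux `WindowTraceArch`,
`Σᵢ (1 + γᵢ²)⁻¹ < ∞` (local Weyl law `card_near_le_log_of_windowTraceArch_witness` and cell
counting; nonnegative families with bounded partial sums are summable). [folklore] -/
theorem stub_bandlimitedTest_summable_of_witness {ι : Type} {γ : ι → ℝ}
    (hγ : ∀ g : ℝ → ℂ, IsWeilTest g → tsupport g ⊆ Icc (-Real.log 2) (Real.log 2) →
      HasSum (fun i => weilMellin g (1 / 2 + (γ i : ℂ) * I)) (weilFunctional g)) :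
    Summable fun i => (1 + γ i ^ 2)⁻¹ := by
  obtain ⟨C, -, hC⟩ := card_near_le_log_of_windowTraceArch_witness hγ
  have h0 : ∀ i, 0 ≤ (1 + γ i ^ 2)⁻¹ := fun i => by positivity
  exact summable_of_sum_le h0 (stub_bandlimitedTest_sum_le γ C hC)

/-! ## Dilation and mollification: the approximants -/

/-- Transform of a dilate: for `c > 0`, `(g(c ·))^(s) = c⁻¹ ĝ(1/2 + (s - 1/2)/c)` (substitute
`t ↦ t / c`; no hypothesis on `g`). [folklore] -/
theorem stub_bandlimitedTest_weilMellin_dilate (g : ℝ → ℂ) {c : ℝ} (hc : 0 < c) (s : ℂ) :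
    weilMellin (fun t => g (c * t)) s = (c : ℂ)⁻¹ * weilMellin g (1 / 2 + (s - 1 / 2) / c) := by
  unfold weilMellin
  have hc' : (c : ℂ) ≠ 0 := by exact_mod_cast hc.ne'
  have key : (fun t : ℝ => g (c * t) * cexp ((s - 1 / 2) * (t : ℂ))) =
      fun t : ℝ => (fun y : ℝ => g y * cexp ((s - 1 / 2) / c * (y : ℂ))) (c * t) := by
    funext t
    simp only
    congr 2
    push_cast
    field_simp
  rw [key, Measure.integral_comp_mul_left (fun y : ℝ => g y * cexp ((s - 1 / 2) / c * (y : ℂ))) c,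
    abs_of_pos (inv_pos.2 hc), ← Complex.coe_smul, Complex.ofReal_inv, smul_eq_mul]
  congr 1
  refine integral_congr_ae (Eventually.of_forall fun y => ?_)
  simp only
  congr 2
  ring

/-- The Weil convolution of the complexified normalised bump `φ̄` with `G` is Mathlib's
real-scalar convolution `φ̄ ⋆ G` (unfolding). [folklore] -/
theorem stub_bandlimitedTest_weilConv_eq (φ : ContDiffBump (0 : ℝ)) (G : ℝ → ℂ) (x : ℝ) :
    weilConv (fun t => ((φ.normed volume t : ℝ) : ℂ)) G x =
      (φ.normed volume ⋆[ContinuousLinearMap.lsmul ℝ ℝ, volume] G) x := by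
  rw [weilConv_apply, convolution_def]
  simp only [ContinuousLinearMap.lsmul_apply, Complex.real_smul]

/-- The complexified normalised bump `φ̄ = φ.normed` is a Weil test. [folklore] -/
theorem stub_bandlimitedTest_bump_isWeilTest (φ : ContDiffBump (0 : ℝ)) :
    IsWeilTest (fun t => ((φ.normed volume t : ℝ) : ℂ)) := by
  refine ⟨?_, φ.hasCompactSupport_normed.comp_left Complex.ofReal_zero⟩
  have h := Complex.ofRealCLM.contDiff.comp (φ.contDiff_normed (μ := volume) (n := ⊤))
  simpa [Function.comp_def] using h

/-- The complexified normalised bump is supported in `[-r, r]`, `r = φ.rOut`. [folklore] -/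
theorem stub_bandlimitedTest_bump_support (φ : ContDiffBump (0 : ℝ)) :
    Function.support (fun t => ((φ.normed volume t : ℝ) : ℂ)) ⊆ Icc (-φ.rOut) φ.rOut := by
  intro t ht
  have ht' : φ.normed volume t ≠ 0 := fun h => ht (by simp [h])
  have hmem : t ∈ Metric.ball (0 : ℝ) φ.rOut := by rwa [← φ.support_normed_eq (μ := volume)]
  rw [Metric.mem_ball, Real.dist_eq, sub_zero] at hmem
  exact ⟨by linarith [(abs_lt.1 hmem).1], (abs_lt.1 hmem).2.le⟩

/-- On the critical line the transform of the normalised bump is bounded by its mass: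
`|φ̄^(1/2 + iu)| ≤ ∫ φ̄ = 1`. [folklore] -/
theorem stub_bandlimitedTest_bump_norm_le (φ : ContDiffBump (0 : ℝ)) (u : ℝ) :
    ‖weilMellin (fun t => ((φ.normed volume t : ℝ) : ℂ)) (1 / 2 + u * I)‖ ≤ 1 := by
  refine (norm_weilMellin_half_line_le (stub_bandlimitedTest_bump_isWeilTest φ) u).trans ?_
  unfold weilNorm1
  have h : ∀ x, ‖((φ.normed volume x : ℝ) : ℂ)‖ = φ.normed volume x := fun x => by
    rw [Complex.norm_real, Real.norm_eq_abs, abs_of_nonneg (φ.nonneg_normed x)]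
  simp_rw [h]
  exact (φ.integral_normed).le

/-- As the radius shrinks, the transform of the normalised bump tends to `1` at every `s`:
`φ̄^(s) = (φ̄ ⋆ e^{-(s-1/2)(·)})(0) → e^0 = 1`. [folklore] -/
theorem stub_bandlimitedTest_bump_tendsto {φ : ℕ → ContDiffBump (0 : ℝ)}
    (hφ : Tendsto (fun k => (φ k).rOut) atTop (𝓝 0)) (s : ℂ) :
    Tendsto (fun k => weilMellin (fun t => (((φ k).normed volume t : ℝ) : ℂ)) s) atTop (𝓝 1) := by
  set f : ℝ → ℂ := fun x => cexp ((s - 1 / 2) * ((-x : ℝ) : ℂ)) with hf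
  have hfc : Continuous f := by
    rw [hf]
    fun_prop
  have key : ∀ k, weilMellin (fun t => (((φ k).normed volume t : ℝ) : ℂ)) s =
      ((φ k).normed volume ⋆[ContinuousLinearMap.lsmul ℝ ℝ, volume] f) 0 := by
    intro k
    rw [weilMellin, convolution_def]
    refine integral_congr_ae (Eventually.of_forall fun t => ?_)
    simp only [hf, ContinuousLinearMap.lsmul_apply, Complex.real_smul, zero_sub, neg_neg]
  have h := ContDiffBump.convolution_tendsto_right_of_continuous (μ := volume) hφ hfc (0 : ℝ)
  have hf0 : f 0 = 1 := by simp [hf]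
  rw [hf0] at h
  simpa only [key] using h

/-- **The approximants.** For `g` continuous with `tsupport g ⊆ [-A, A]`, a dilation factor
`c ≥ 1` and a bump `φ` of radius `r` with `A/c + r ≤ A`, the mollified dilate `h = φ̄ ⋆ g(c ·)` is
a Weil test supported in `[-A, A]`, and `ĥ(s) = φ̄^(s) · c⁻¹ ĝ(1/2 + (s - 1/2)/c)`
(`weilMellin_weilConv_holds` and the change of variables `t ↦ t/c`). [folklore] -/
theorem stub_bandlimitedTest_approx {g : ℝ → ℂ} (hg : Continuous g) {A : ℝ}
    (hgA : tsupport g ⊆ Icc (-A) A) {c : ℝ} (hc : 1 ≤ c) (φ : ContDiffBump (0 : ℝ))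
    (hr : A / c + φ.rOut ≤ A) :
    IsWeilTest (weilConv (fun t => ((φ.normed volume t : ℝ) : ℂ)) (fun t => g (c * t))) ∧
    tsupport (weilConv (fun t => ((φ.normed volume t : ℝ) : ℂ)) (fun t => g (c * t))) ⊆
      Icc (-A) A ∧
    ∀ s : ℂ, weilMellin (weilConv (fun t => ((φ.normed volume t : ℝ) : ℂ)) (fun t => g (c * t))) s =
      weilMellin (fun t => ((φ.normed volume t : ℝ) : ℂ)) s *
        ((c : ℂ)⁻¹ * weilMellin g (1 / 2 + (s - 1 / 2) / c)) := by
  set Φ : ℝ → ℂ := fun t => ((φ.normed volume t : ℝ) : ℂ) with hΦ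
  set G : ℝ → ℂ := fun t => g (c * t) with hG
  have hc0 : 0 < c := by linarith
  have hΦw : IsWeilTest Φ := stub_bandlimitedTest_bump_isWeilTest φ
  have hGc : Continuous G := by
    rw [hG]
    fun_prop
  -- support of the dilate
  have hGs : Function.support G ⊆ Icc (-(A / c)) (A / c) := by
    intro t ht
    have h1 : c * t ∈ tsupport g := subset_tsupport _ ht
    obtain ⟨h2, h3⟩ := hgA h1
    constructor
    · rw [neg_le, le_div_iff₀ hc0]
      nlinarith
    · rw [le_div_iff₀ hc0]
      nlinarith
  have hGts : tsupport G ⊆ Icc (-(A / c)) (A / c) := closure_minimal hGs isClosed_Icc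
  have hGcs : HasCompactSupport G :=
    isCompact_Icc.of_isClosed_subset (isClosed_tsupport _) hGts
  have hΦs := stub_bandlimitedTest_bump_support φ
  refine ⟨?_, ?_, fun s => ?_⟩
  · rw [weilConv_eq_convolution_real]
    exact ⟨hΦw.2.contDiff_convolution_left (ContinuousLinearMap.mul ℝ ℂ) hΦw.1
        hGc.locallyIntegrable,
      HasCompactSupport.convolution (ContinuousLinearMap.mul ℝ ℂ) hΦw.2 hGcs⟩
  · rw [weilConv_eq_convolution_real]
    refine closure_minimal ((support_convolution_subset_swap _).trans ?_) isClosed_Icc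
    rintro _ ⟨a, ha, b, hb, rfl⟩
    obtain ⟨ha1, ha2⟩ := hGs ha
    obtain ⟨hb1, hb2⟩ := hΦs hb
    constructor <;> linarith
  · rw [weilMellin_weilConv_holds hΦw.1.continuous hΦw.2 hGc hGcs s,
      stub_bandlimitedTest_weilMellin_dilate g hc0 s]

/-- The approximants converge at `0`: `(φ̄ₖ ⋆ g(cₖ ·))(0) → g(0)` when `rₖ → 0` and `cₖ → 1`
(`ContDiffBump.convolution_tendsto_right`). [folklore] -/
theorem stub_bandlimitedTest_value_tendsto {g : ℝ → ℂ} (hg : Continuous g) {c : ℕ → ℝ}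
    (hc : Tendsto c atTop (𝓝 1)) {φ : ℕ → ContDiffBump (0 : ℝ)}
    (hφ : Tendsto (fun k => (φ k).rOut) atTop (𝓝 0)) :
    Tendsto (fun k => weilConv (fun t => (((φ k).normed volume t : ℝ) : ℂ)) (fun t => g (c k * t)) 0)
      atTop (𝓝 (g 0)) := by
  simp_rw [stub_bandlimitedTest_weilConv_eq]
  refine ContDiffBump.convolution_tendsto_right hφ
    (Eventually.of_forall fun k => (by fun_prop : Continuous fun t => g (c k * t)).aestronglyMeasurable)
    ?_ tendsto_const_nhds
  have h1 : Tendsto (fun p : ℕ × ℝ => c p.1 * p.2) (atTop ×ˢ 𝓝 (0 : ℝ)) (𝓝 0) := by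
    have h := (hc.comp tendsto_fst).mul
      (tendsto_snd : Tendsto Prod.snd (atTop ×ˢ 𝓝 (0 : ℝ)) (𝓝 0))
    simpa using h
  exact (hg.tendsto 0).comp h1

/-! ## The archimedean side: dominated convergence -/

/-- **Dominated convergence for the archimedean integrals.** If the transforms `F̂ₖ(1/2 + it)`
are bounded by `M/(1 + t²)` uniformly in `k` and converge pointwise to `ĝ(1/2 + it)` (all
functions continuous of compact support), then `∫ F̂ₖ(1/2+it) Re ψ(1/4+it/2) dt →
∫ ĝ(1/2+it) Re ψ(1/4+it/2) dt`; majorant `M (|C_ψ| + 2 log(1 + |t|))/(1/4 + t²)` from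
`‖ψ(1/4 + iy)‖ ≤ C_ψ + log(1 + |y|)`. [folklore] -/
theorem stub_bandlimitedTest_arch_tendsto {F : ℕ → ℝ → ℂ} {g : ℝ → ℂ} {M : ℝ}
    (hF : ∀ k, Continuous (F k)) (hF' : ∀ k, HasCompactSupport (F k))
    (hbd : ∀ (k : ℕ) (t : ℝ), ‖weilMellin (F k) (1 / 2 + t * I)‖ ≤ M * (1 + t ^ 2)⁻¹)
    (hpt : ∀ t : ℝ, Tendsto (fun k => weilMellin (F k) (1 / 2 + t * I)) atTop
      (𝓝 (weilMellin g (1 / 2 + t * I)))) :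
    Tendsto (fun k => weilArchIntegral (F k)) atTop (𝓝 (weilArchIntegral g)) := by
  obtain ⟨C, hC⟩ :=
    Literature.Analysis.SpecialFunctions.Complex.exists_norm_digamma_vertical_le
      (a := 1 / 4) (by norm_num)
  set Ψ : ℝ → ℂ := fun t => ((Complex.digamma (1 / 4 + t / 2 * I)).re : ℂ) with hΨ
  have hw : ∀ t : ℝ, (1 / 4 : ℂ) + (t : ℂ) / 2 * I = ((1 / 4 : ℝ) : ℂ) + ((t / 2 : ℝ) : ℂ) * I := by
    intro t; push_cast; ring
  have hΨc : Continuous Ψ := by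
    refine continuous_ofReal.comp (Complex.continuous_re.comp ?_)
    refine Literature.Analysis.SpecialFunctions.Complex.continuousOn_digamma.comp_continuous
      (by fun_prop) fun t => ?_
    rw [hw t]
    simp
  have hΨb : ∀ t : ℝ, ‖Ψ t‖ ≤ |C| + Real.log (1 + |t|) := by
    intro t
    have h1 : ‖Ψ t‖ ≤ ‖Complex.digamma (1 / 4 + t / 2 * I)‖ := by
      simp only [hΨ, Complex.norm_real, Real.norm_eq_abs]
      exact Complex.abs_re_le_norm _
    have h2 := hC (t / 2)
    rw [← hw t] at h2
    have h3 : Real.log (1 + |t / 2|) ≤ Real.log (1 + |t|) := by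
      refine Real.log_le_log (by positivity) ?_
      rw [abs_div, abs_two]
      linarith [abs_nonneg t]
    linarith [le_abs_self C]
  have hM : 0 ≤ M := by
    have h := (norm_nonneg _).trans (hbd 0 0)
    simpa using h
  -- the majorant
  set bound : ℝ → ℝ := fun t => M * ((|C| + 2 * Real.log (1 + |t|)) / (1 / 4 + t ^ 2))
    with hbound
  have hbi : Integrable bound :=
    (PsiOneExplicit.integrable_left_majorant (abs_nonneg C)).const_mul M
  unfold weilArchIntegral
  refine tendsto_integral_of_dominated_convergence bound
    (fun k => (((continuous_weilMellin (hF k) (hF' k)).comp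
      (by fun_prop : Continuous fun t : ℝ => (1 / 2 : ℂ) + t * I)).mul hΨc).aestronglyMeasurable)
    hbi (fun k => Eventually.of_forall fun t => ?_)
    (Eventually.of_forall fun t => (hpt t).mul_const _)
  -- the domination
  have hlog : 0 ≤ Real.log (1 + |t|) := Real.log_nonneg (by linarith [abs_nonneg t])
  rw [norm_mul]
  calc ‖weilMellin (F k) (1 / 2 + t * I)‖ * ‖Ψ t‖
      ≤ M * (1 + t ^ 2)⁻¹ * (|C| + Real.log (1 + |t|)) :=
        mul_le_mul (hbd k t) (hΨb t) (norm_nonneg _) (by positivity)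
    _ ≤ bound t := by
        show _ ≤ M * ((|C| + 2 * Real.log (1 + |t|)) / (1 / 4 + t ^ 2))
        rw [mul_assoc]
        refine mul_le_mul_of_nonneg_left ?_ hM
        rw [← div_eq_inv_mul, div_le_div_iff₀ (by positivity) (by positivity)]
        nlinarith [mul_nonneg hlog (sq_nonneg t), abs_nonneg C]

/-! ## Landing anchor -/

/-- **Landing anchor of this auxiliary file** (registered sub-goal `stub_bandlimitedTest_summable`
of item stmt-RiemannHypothesis-11195, serving the stub `stub_bandlimitedTest`): for every witness
`γ` of the crux `WindowTraceArch` the series `Σᵢ (1 + γᵢ²)⁻¹` converges (binder-free restatement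
of `stub_bandlimitedTest_summable_of_witness`). [folklore] -/
theorem stub_bandlimitedTest_summable :
    ∀ (ι : Type) (γ : ι → ℝ),
      (∀ g : ℝ → ℂ, Literature.NumberTheory.LFunctions.IsWeilTest g →
        tsupport g ⊆ Set.Icc (-Real.log 2) (Real.log 2) →
        HasSum (fun i => Literature.NumberTheory.LFunctions.weilMellin g (1 / 2 + (γ i : ℂ) * Complex.I))
          (Literature.NumberTheory.LFunctions.weilFunctional g)) →
      Summable (fun i : ι => (1 + γ i ^ 2)⁻¹) :=
  fun _ _ hγ => stub_bandlimitedTest_summable_of_witness hγ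

end Summit.RiemannHypothesis.RiemannHypothesis.Theorems.SpectralTraceWindowTraceArch

end
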